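import Mathlib.RingTheory.MvPolynomial.Homogeneous
import Mathlib.Algebra.MvPolynomial.NoZeroDivisors
import Mathlib.Algebra.MvPolynomial.Nilpotent
import Mathlib.Algebra.MvPolynomial.Equiv
import Mathlib.Algebra.Polynomial.Reverse
import Mathlib.Algebra.Polynomial.Degree.Units
import HarnessLib

/-!
# Homogenisation and dilation preserve irreducibility

Two elementary facts about an irreducible polynomial `P ∈ D[W₁, …, W_s]` over a domain `D`, of
total degree `δ`, with homogeneous components `P = P₀ + P₁ + ⋯ + P_δ`:

* `irreducible_homogenization`: the homogenisation `P^h = ∑ₖ P_k U^{δ-k} ∈ D[W, U]` is irreducible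
  (if `P^h = A B` then `P = A(1) B(1)`, say `A(1)` is a unit; counting total degrees,
  `δ = deg A + deg B ≥ deg A + deg B(1) = deg A + δ`, so `A` is a constant, equal to `A(1)`);
* `irreducible_dilation`: if moreover `P(0) ≠ 0`, the *dilation*
  `P(U W₁, …, U W_s) = ∑ₖ P_k U^k ∈ D[W][U]` is irreducible (it is the `U`-reversal of `P^h`, and
  reversal is multiplicative over a domain).

The dilation is the shape of the restriction `f(μ + v X + Y·Z)` of a polynomial to the generic
plane through the line `{μ + X v}`, as a polynomial in `Y` and the plane coordinates `Z`; its
irreducibility (for `f` irreducible over `K̄`) is the starting point of Kaltofen's effective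
Hilbert irreducibility / Bertini theorem used by Cafure–Matera (2006, §3.2, Cor. 3.2) — see the
sibling Bertini files. Here only the abstract algebra is done; no definitions are introduced (the
homogenisation is the displayed sum).

## References

* E. Kaltofen, *Effective Noether irreducibility forms and applications*, J. Comput. System Sci.
  50 (1995) 274–295, §3. [Kaltofen1995]
* A. Cafure, G. Matera, Finite Fields Appl. 12 (2006) 155–185, §3.2. [CafureMatera2006]
-/

noncomputable section

open scoped Classical Polynomial
open MvPolynomial

namespace Literature.NumberTheory.DiophantineGeometry

universe u v

variable {D : Type u} [CommRing D] {σ : Type v}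

/-! ### Substitutions by polynomials of degree `≤ 1` do not raise the total degree -/

/-- If every `θ i` has total degree `≤ 1` then `deg f(θ) ≤ deg f`. [folklore] -/
theorem totalDegree_aeval_le_of_forall_le_one {τ : Type*} {A : Type*} [CommRing A] [Algebra D A]
    (θ : σ → MvPolynomial τ A) (hθ : ∀ i, (θ i).totalDegree ≤ 1) (f : MvPolynomial σ D) :
    (aeval θ f).totalDegree ≤ f.totalDegree := by
  conv_lhs => rw [f.as_sum]
  rw [map_sum]
  refine totalDegree_finsetSum_le fun m hm ↦ ?_
  rw [aeval_monomial, Finsupp.prod]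
  refine (totalDegree_mul _ _).trans ?_
  have h1 : (algebraMap D (MvPolynomial τ A) (f.coeff m)).totalDegree = 0 := by
    rw [IsScalarTower.algebraMap_apply D A (MvPolynomial τ A), MvPolynomial.algebraMap_eq,
      totalDegree_C]
  rw [h1, zero_add]
  refine (totalDegree_finsetProd _ _).trans ?_
  calc ∑ i ∈ m.support, (θ i ^ m i).totalDegree ≤ ∑ i ∈ m.support, m i := by
        refine Finset.sum_le_sum fun i _ ↦ (totalDegree_pow _ _).trans ?_
        calc m i * (θ i).totalDegree ≤ m i * 1 := Nat.mul_le_mul_left _ (hθ i)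
          _ = m i := mul_one _
    _ = m.sum fun _ e ↦ e := rfl
    _ ≤ f.totalDegree := le_totalDegree hm

/-! ### Homogenisation `P^h = ∑ₖ P_k U^{δ-k}` in `D[W][U] = MvPolynomial (Option σ) D` -/

section Homogenization

/-- The homogenisation `∑_{k ≤ δ} P_k · U^{δ-k}` (`U = X none`, `P_k` the homogeneous components,
`δ = deg P`) is homogeneous of degree `δ`. [folklore] -/
theorem isHomogeneous_homogenization (P : MvPolynomial σ D) :
    IsHomogeneous (∑ k ∈ Finset.range (P.totalDegree + 1),
      rename some (homogeneousComponent k P) * X none ^ (P.totalDegree - k)) P.totalDegree := by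
  refine IsHomogeneous.sum _ _ _ fun k hk ↦ ?_
  rw [Finset.mem_range] at hk
  have h1 : IsHomogeneous (rename some (homogeneousComponent k P) : MvPolynomial (Option σ) D) k :=
    (homogeneousComponent_isHomogeneous k P).rename_isHomogeneous
  have h2 : IsHomogeneous (X none ^ (P.totalDegree - k) : MvPolynomial (Option σ) D)
      (1 * (P.totalDegree - k)) := (isHomogeneous_X D none).pow _
  have := h1.mul h2
  rwa [one_mul, Nat.add_sub_cancel' (by omega)] at this

/-- Dehomogenisation `U ↦ 1` recovers `P`. [folklore] -/
theorem aeval_elim_homogenization (P : MvPolynomial σ D) :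
    aeval (fun o : Option σ ↦ (o.elim 1 X : MvPolynomial σ D))
      (∑ k ∈ Finset.range (P.totalDegree + 1),
      rename some (homogeneousComponent k P) * X none ^ (P.totalDegree - k)) = P := by
  rw [map_sum]
  conv_rhs => rw [← sum_homogeneousComponent P]
  refine Finset.sum_congr rfl fun k _ ↦ ?_
  rw [map_mul, map_pow, aeval_X, Option.elim, one_pow, mul_one, aeval_rename]
  change aeval X (homogeneousComponent k P) = _
  rw [aeval_X_left, AlgHom.id_apply]

/-- The total degree does not increase under dehomogenisation `U ↦ 1`. [folklore] -/
theorem totalDegree_aeval_elim_le (Q : MvPolynomial (Option σ) D) :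
    (aeval (fun o : Option σ ↦ (o.elim 1 X : MvPolynomial σ D)) Q).totalDegree ≤ Q.totalDegree :=
  totalDegree_aeval_le_of_forall_le_one _ (fun o ↦ by
    cases o with
    | none => simp
    | some i =>
      change (X i : MvPolynomial σ D).totalDegree ≤ 1
      rcases subsingleton_or_nontrivial D with hD | hD
      · rw [Subsingleton.elim (X i : MvPolynomial σ D) 0, totalDegree_zero]
        exact Nat.zero_le _
      · rw [totalDegree_X]) Q

variable [IsDomain D]

/-- **Homogenisation preserves irreducibility.** If `P ∈ D[W]` is irreducible over a domain `D`
then `P^h = ∑_{k ≤ δ} P_k U^{δ-k} ∈ D[W, U]` is irreducible: from `P^h = A B` dehomogenise to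
`P = A(1) B(1)`, so w.l.o.g. `A(1)` is a unit, and `δ = deg A + deg B ≥ deg A + deg P` forces
`deg A = 0`, `A = A(1)`. [folklore] -/
theorem irreducible_homogenization {P : MvPolynomial σ D} (hP : Irreducible P) :
    Irreducible (∑ k ∈ Finset.range (P.totalDegree + 1),
      rename some (homogeneousComponent k P) * X none ^ (P.totalDegree - k)) := by
  set δ := P.totalDegree with hδ
  set Ph := ∑ k ∈ Finset.range (δ + 1),
      rename some (homogeneousComponent k P) * X none ^ (δ - k) with hPh
  set dh : MvPolynomial (Option σ) D →ₐ[D] MvPolynomial σ D :=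
    aeval fun o : Option σ ↦ (o.elim 1 X : MvPolynomial σ D) with hdh
  have hdhPh : dh Ph = P := aeval_elim_homogenization P
  have hP0 : P ≠ 0 := hP.ne_zero
  have hPh0 : Ph ≠ 0 := fun h ↦ hP0 (by rw [← hdhPh, h, map_zero])
  have hPhdeg : Ph.totalDegree = δ := (isHomogeneous_homogenization P).totalDegree hPh0
  refine ⟨fun hu ↦ hP.not_isUnit (hdhPh ▸ hu.map dh), fun A B hAB ↦ ?_⟩
  have hA0 : A ≠ 0 := fun h ↦ hPh0 (by rw [hAB, h, zero_mul])
  have hB0 : B ≠ 0 := fun h ↦ hPh0 (by rw [hAB, h, mul_zero])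
  have hdeg : A.totalDegree + B.totalDegree = δ := by
    rw [← totalDegree_mul_of_isDomain hA0 hB0, ← hAB, hPhdeg]
  have hPAB : P = dh A * dh B := by rw [← hdhPh, hAB, map_mul]
  -- a constant factor whose dehomogenisation is a unit is a unit
  have key : ∀ {A B : MvPolynomial (Option σ) D}, A.totalDegree + B.totalDegree = δ →
      P = dh A * dh B → IsUnit (dh A) → IsUnit A := by
    intro A B hdeg hPAB hu
    obtain ⟨u, hu, huA⟩ := (isUnit_iff_eq_C_of_isReduced).1 hu
    have hdB : (dh B).totalDegree ≤ B.totalDegree := totalDegree_aeval_elim_le B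
    have hPd : P.totalDegree ≤ (dh B).totalDegree := by
      rw [hPAB, huA]
      refine (totalDegree_mul _ _).trans ?_
      rw [totalDegree_C, zero_add]
    have hA0 : A.totalDegree = 0 := by omega
    rw [totalDegree_eq_zero_iff_eq_C] at hA0
    have hdhA : dh A = C (A.coeff 0) := by
      conv_lhs => rw [hA0]
      rw [hdh, aeval_C, MvPolynomial.algebraMap_eq]
    rw [hdhA] at huA
    have hau : A.coeff 0 = u := C_injective _ _ huA
    rw [hA0, hau]
    exact hu.map C
  rcases hP.isUnit_or_isUnit hPAB with hu | hu
  · exact Or.inl (key hdeg hPAB hu)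
  · refine Or.inr (key ((add_comm _ _).trans hdeg) (hPAB.trans (mul_comm _ _)) hu)

end Homogenization

/-! ### The dilation `P(U·W) = ∑ₖ P_k Uᵏ` in `D[W][U]` -/

section Dilation

/-- The top homogeneous component of a nonzero polynomial is nonzero. [folklore] -/
theorem homogeneousComponent_totalDegree_ne_zero {P : MvPolynomial σ D} (hP : P ≠ 0) :
    homogeneousComponent P.totalDegree P ≠ 0 := by
  obtain ⟨m, hm, hdeg⟩ := Finset.exists_mem_eq_sup P.support (support_nonempty.2 hP)
    (fun s : σ →₀ ℕ ↦ s.sum fun _ e ↦ e)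
  intro h
  have := congrArg (coeff m) h
  have hmdeg : m.degree = P.totalDegree := by
    rw [totalDegree, hdeg]
    rfl
  rw [coeff_homogeneousComponent, coeff_zero, if_pos hmdeg] at this
  exact (mem_support_iff.1 hm) this

/-- The substitution `Wᵢ ↦ U·Wᵢ` sends `P` to `∑ₖ P_k Uᵏ`. [folklore] -/
theorem aeval_C_X_mul_X_eq_sum (P : MvPolynomial σ D) :
    aeval (fun i ↦ Polynomial.C (X i) * Polynomial.X : σ → Polynomial (MvPolynomial σ D)) P =
      ∑ k ∈ Finset.range (P.totalDegree + 1),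
        Polynomial.C (homogeneousComponent k P) * Polynomial.X ^ k := by
  -- on a monomial `c W^m` the substitution gives `C (c W^m) U^{|m|}`
  have hmon : ∀ (m : σ →₀ ℕ) (c : D),
      aeval (fun i ↦ Polynomial.C (X i) * Polynomial.X : σ → Polynomial (MvPolynomial σ D))
        (monomial m c) = Polynomial.C (monomial m c) * Polynomial.X ^ m.degree := by
    intro m c
    rw [aeval_monomial, Finsupp.prod, IsScalarTower.algebraMap_apply D (MvPolynomial σ D),
      MvPolynomial.algebraMap_eq, Polynomial.algebraMap_eq]
    simp_rw [mul_pow, Finset.prod_mul_distrib, ← map_pow, ← map_prod, Finset.prod_pow_eq_pow_sum]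
    rw [← mul_assoc, ← map_mul]
    congr 2
    rw [← Finsupp.prod, ← MvPolynomial.monomial_eq]
  conv_lhs => rw [P.as_sum, map_sum]
  simp_rw [hmon]
  symm
  rw [← Finset.sum_fiberwise_of_maps_to (g := fun m : σ →₀ ℕ ↦ m.degree)
    (s := P.support) (t := Finset.range (P.totalDegree + 1)) (fun m hm ↦ by
      rw [Finset.mem_range, Nat.lt_succ_iff]
      exact le_totalDegree hm)]
  refine Finset.sum_congr rfl fun k _ ↦ ?_
  rw [homogeneousComponent_apply, map_sum, Finset.sum_mul]
  refine Finset.sum_congr rfl fun m hm ↦ ?_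
  rw [Finset.mem_filter] at hm
  rw [hm.2]

/-- Reflection is additive over finite sums. [folklore] -/
theorem reflect_sum {R : Type*} [Semiring R] {ι : Type*} (s : Finset ι) (g : ι → R[X]) (N : ℕ) :
    Polynomial.reflect N (∑ i ∈ s, g i) = ∑ i ∈ s, Polynomial.reflect N (g i) := by
  induction s using Finset.induction_on with
  | empty => simp
  | insert a s ha ih => rw [Finset.sum_insert ha, Finset.sum_insert ha, Polynomial.reflect_add, ih]

/-- A polynomial whose reverse is a constant `C u` is `u · U^{deg}`. [folklore] -/
theorem eq_C_mul_X_pow_of_reverse_eq_C {R : Type*} [Semiring R] {A : R[X]} {u : R}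
    (h : A.reverse = Polynomial.C u) : A = Polynomial.C u * Polynomial.X ^ A.natDegree := by
  ext j
  rw [Polynomial.coeff_C_mul_X_pow]
  rcases lt_trichotomy j A.natDegree with hj | hj | hj
  · rw [if_neg hj.ne]
    have := congrArg (fun p : R[X] ↦ p.coeff (A.natDegree - j)) h
    simp only [Polynomial.coeff_reverse, Polynomial.coeff_C,
      Nat.sub_eq_zero_iff_le, not_le.2 hj, if_false] at this
    rwa [Polynomial.revAt_le (Nat.sub_le _ _), Nat.sub_sub_self hj.le] at this
  · subst hj
    rw [if_pos rfl]
    have := Polynomial.coeff_zero_reverse A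
    rw [h, Polynomial.coeff_C_zero] at this
    exact this.symm
  · rw [if_neg hj.ne', Polynomial.coeff_eq_zero_of_natDegree_lt hj]

variable [IsDomain D]

/-- **Dilation preserves irreducibility.** If `P ∈ D[W]` is irreducible over a domain `D` with
`P(0) ≠ 0`, then `P(U W₁, …, U W_s) = ∑ₖ P_k Uᵏ ∈ D[W][U]` is irreducible: it is the
`U`-reversal of the homogenisation `∑ₖ P_k U^{δ-k}` (irreducible, `irreducible_homogenization`,
read in `D[W][U]` through `MvPolynomial.optionEquivLeft`), reversal is multiplicative over a
domain, and a factor `u Uʲ` with `j > 0` is excluded by `P(0) ≠ 0`. [folklore] -/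
theorem irreducible_dilation {P : MvPolynomial σ D} (hP : Irreducible P) (h0 : coeff 0 P ≠ 0) :
    Irreducible (∑ k ∈ Finset.range (P.totalDegree + 1),
      Polynomial.C (homogeneousComponent k P) * Polynomial.X ^ k :
        Polynomial (MvPolynomial σ D)) := by
  set δ := P.totalDegree with hδ
  set Dl : Polynomial (MvPolynomial σ D) := ∑ k ∈ Finset.range (δ + 1),
      Polynomial.C (homogeneousComponent k P) * Polynomial.X ^ k with hDl
  set Ph : MvPolynomial (Option σ) D := ∑ k ∈ Finset.range (δ + 1),
      rename some (homogeneousComponent k P) * X none ^ (δ - k) with hPh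
  set e := optionEquivLeft D σ with he
  have hP0 : P ≠ 0 := hP.ne_zero
  -- `Dl` has degree `δ` with nonzero constant term `P₀ = P(0)`
  have hcoeff : ∀ j, Dl.coeff j = if j ≤ δ then homogeneousComponent j P else 0 := by
    intro j
    rw [hDl, Polynomial.finsetSum_coeff]
    simp_rw [Polynomial.coeff_C_mul_X_pow]
    rw [Finset.sum_ite_eq]
    simp only [Finset.mem_range, Nat.lt_succ_iff]
  have hDl0 : Dl.coeff 0 ≠ 0 := by
    rw [hcoeff, if_pos (Nat.zero_le _), homogeneousComponent_zero]
    exact (map_ne_zero_iff _ (C_injective σ D)).2 h0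
  have hDlδ : Dl.coeff δ ≠ 0 := by
    rw [hcoeff, if_pos le_rfl]
    exact homogeneousComponent_totalDegree_ne_zero hP0
  have hDldeg : Dl.natDegree = δ := by
    refine le_antisymm ?_ (Polynomial.le_natDegree_of_ne_zero hDlδ)
    rw [Polynomial.natDegree_le_iff_coeff_eq_zero]
    intro j hj
    rw [hcoeff, if_neg (by omega)]
  -- `e Ph = reverse Dl`
  have herename : ∀ R : MvPolynomial σ D, e (rename some R) = Polynomial.C R := by
    intro R
    have h1 : (e.toAlgHom.comp (rename some) : MvPolynomial σ D →ₐ[D] _) =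
        (Polynomial.CAlgHom : MvPolynomial σ D →ₐ[D] Polynomial (MvPolynomial σ D)) := by
      refine MvPolynomial.algHom_ext fun i ↦ ?_
      simp [he, optionEquivLeft_X_some]
    exact DFunLike.congr_fun h1 R
  have hePh : e Ph = Dl.reverse := by
    rw [Polynomial.reverse, hDldeg, hDl, reflect_sum, hPh, map_sum]
    refine Finset.sum_congr rfl fun k hk ↦ ?_
    rw [Finset.mem_range, Nat.lt_succ_iff] at hk
    rw [map_mul, map_pow, herename, he, optionEquivLeft_X_none, Polynomial.reflect_C_mul_X_pow,
      Polynomial.revAt_le hk]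
  have hirrQ : Irreducible Dl.reverse := by
    rw [← hePh]
    exact (MulEquiv.irreducible_iff e).2 (irreducible_homogenization hP)
  -- evaluation at `U = 1` recovers `P`
  have heval : Dl.eval 1 = P := by
    rw [hDl, Polynomial.eval_finsetSum]
    simp_rw [Polynomial.eval_mul, Polynomial.eval_C, Polynomial.eval_pow, Polynomial.eval_X,
      one_pow, mul_one]
    exact sum_homogeneousComponent P
  refine ⟨fun hu ↦ hP.not_isUnit ?_, fun A B hAB ↦ ?_⟩
  · have h1 := hu.map (Polynomial.evalRingHom 1)
    rwa [Polynomial.coe_evalRingHom, heval] at h1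
  -- a factor whose reverse is a unit is a unit
  have key : ∀ {A : Polynomial (MvPolynomial σ D)}, A ∣ Dl → IsUnit A.reverse → IsUnit A := by
    intro A hA hu
    obtain ⟨u, hu, huA⟩ := Polynomial.isUnit_iff.1 hu
    have hAeq := eq_C_mul_X_pow_of_reverse_eq_C huA.symm
    rcases Nat.eq_zero_or_pos A.natDegree with hN | hN
    · rw [hAeq, hN, pow_zero, mul_one]
      exact Polynomial.isUnit_C.2 hu
    · exfalso
      apply hDl0
      rw [← Polynomial.X_dvd_iff]
      calc (Polynomial.X : Polynomial (MvPolynomial σ D)) ∣ Polynomial.X ^ A.natDegree :=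
            dvd_pow_self _ hN.ne'
        _ ∣ A := by
            conv_rhs => rw [hAeq]
            exact dvd_mul_left _ _
        _ ∣ Dl := hA
  have hrev : Dl.reverse = A.reverse * B.reverse := by rw [hAB, Polynomial.reverse_mul_of_domain]
  have hAdvd : A ∣ Dl := Dvd.intro B hAB.symm
  have hBdvd : B ∣ Dl := Dvd.intro_left A hAB.symm
  rcases hirrQ.isUnit_or_isUnit hrev with hu | hu
  · exact Or.inl (key hAdvd hu)
  · exact Or.inr (key hBdvd hu)

end Dilation

end Literature.NumberTheory.DiophantineGeometry
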